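import Summits.AtomisticToContinuum.Crystallization.Theorems.ExcessDecayLiouvilleSiteGeometry

/-!
# Route `ExcessDecayLiouville`: the one-dimensional discrete Gagliardo–Nirenberg inequality

Item (GN_2), one-dimensional core, of the energy route for item `ExcessDecay` (stmt-AtomisticToContinuum-9334; evidence
`ExcessDecay-proof-architecture-v6.md`, F6 route (i)).  For a finitely supported `g : ℤ → ℝ³`,

`Σ_i ‖g (i+1) − g i‖⁴ ≤ 72 · (sup_i ‖g i‖)² · Σ_i ‖g (i+2) − 2•g (i+1) + g i‖²`   (`tsum_norm_diff_pow_four_le`).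

Proof: `‖D g_i‖⁴ = ⟪D g_i, a_i⟫` with `a_i = ‖Dg_i‖² • Dg_i`; summation by parts `Σ ⟪Dg_i, a_i⟫ = −Σ ⟪g_i, a_i − a_{i−1}⟫`;
the elementary `‖ ‖x‖²x − ‖y‖²y ‖ ≤ (3/2)(‖x‖² + ‖y‖²) ‖x − y‖`; Cauchy–Schwarz and absorption.  At the Caccioppoli levels
`k ≥ 3` it is applied along lattice lines with the FREE Lipschitz smallness `sup ‖D^j h‖ ≤ 2^j ε` as the `L^∞` factor, turning
triple products of `ℓ²`-small differences into absorbable terms.  All `[folklore]`; helper lemmas, nothing here closes an item.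
-/

noncomputable section

namespace Summit.AtomisticToContinuum.Crystallization.Theorems.ExcessDecayLiouville

open scoped BigOperators Topology InnerProductSpace RealInnerProductSpace

/-- `‖ ‖x‖² • x − ‖y‖² • y ‖ ≤ (3/2) (‖x‖² + ‖y‖²) ‖x − y‖` in a real inner product space. [folklore] -/
theorem norm_cube_sub_cube_le (x y : EuclideanSpace ℝ (Fin 3)) :
    ‖(‖x‖ ^ 2) • x - (‖y‖ ^ 2) • y‖ ≤ 3 / 2 * (‖x‖ ^ 2 + ‖y‖ ^ 2) * ‖x - y‖ := by
  -- ‖x‖²x − ‖y‖²y = ‖x‖²(x − y) + (‖x‖² − ‖y‖²) y and |‖x‖² − ‖y‖²| ≤ (‖x‖+‖y‖)‖x − y‖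
  have hdec : (‖x‖ ^ 2) • x - (‖y‖ ^ 2) • y = (‖x‖ ^ 2) • (x - y) + (‖x‖ ^ 2 - ‖y‖ ^ 2) • y := by
    rw [smul_sub, sub_smul]; abel
  -- symmetric decomposition gives the better constant: average the two one-sided decompositions
  have hdec' : (‖x‖ ^ 2) • x - (‖y‖ ^ 2) • y = (‖y‖ ^ 2) • (x - y) + (‖x‖ ^ 2 - ‖y‖ ^ 2) • x := by
    rw [smul_sub, sub_smul]; abel
  have h2 : (2 : ℝ) • ((‖x‖ ^ 2) • x - (‖y‖ ^ 2) • y) =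
      (‖x‖ ^ 2 + ‖y‖ ^ 2) • (x - y) + (‖x‖ ^ 2 - ‖y‖ ^ 2) • (x + y) := by
    calc (2 : ℝ) • ((‖x‖ ^ 2) • x - (‖y‖ ^ 2) • y)
        = ((‖x‖ ^ 2) • x - (‖y‖ ^ 2) • y) + ((‖x‖ ^ 2) • x - (‖y‖ ^ 2) • y) := two_smul _ _
      _ = ((‖x‖ ^ 2) • (x - y) + (‖x‖ ^ 2 - ‖y‖ ^ 2) • y) + ((‖y‖ ^ 2) • (x - y) + (‖x‖ ^ 2 - ‖y‖ ^ 2) • x) := by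
          nth_rewrite 1 [hdec]; rw [hdec']
      _ = (‖x‖ ^ 2 + ‖y‖ ^ 2) • (x - y) + (‖x‖ ^ 2 - ‖y‖ ^ 2) • (x + y) := by
          rw [add_smul, smul_add]; abel
  have hsq : |‖x‖ ^ 2 - ‖y‖ ^ 2| ≤ (‖x‖ + ‖y‖) * ‖x - y‖ := by
    rw [sq_sub_sq, abs_mul, abs_of_nonneg (by positivity)]
    refine mul_le_mul_of_nonneg_left ?_ (by positivity)
    exact abs_norm_sub_norm_le x y
  have hxy : ‖x + y‖ ≤ ‖x‖ + ‖y‖ := norm_add_le x y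
  have hn2 : ‖(2 : ℝ) • ((‖x‖ ^ 2) • x - (‖y‖ ^ 2) • y)‖ = 2 * ‖(‖x‖ ^ 2) • x - (‖y‖ ^ 2) • y‖ := by
    rw [norm_smul, Real.norm_eq_abs, abs_two]
  have hle : 2 * ‖(‖x‖ ^ 2) • x - (‖y‖ ^ 2) • y‖ ≤
      (‖x‖ ^ 2 + ‖y‖ ^ 2) * ‖x - y‖ + (‖x‖ + ‖y‖) * ‖x - y‖ * (‖x‖ + ‖y‖) := by
    rw [← hn2, h2]
    refine (norm_add_le _ _).trans ?_
    rw [norm_smul, norm_smul, Real.norm_eq_abs, Real.norm_eq_abs, abs_of_nonneg (by positivity)]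
    exact add_le_add le_rfl (mul_le_mul hsq hxy (norm_nonneg _) (by positivity))
  have hamgm : (‖x‖ + ‖y‖) * (‖x‖ + ‖y‖) ≤ 2 * (‖x‖ ^ 2 + ‖y‖ ^ 2) := by nlinarith [sq_nonneg (‖x‖ - ‖y‖)]
  nlinarith [hle, hamgm, norm_nonneg (x - y), norm_nonneg x, norm_nonneg y,
    mul_nonneg (norm_nonneg (x - y)) (add_nonneg (sq_nonneg ‖x‖) (sq_nonneg ‖y‖))]

/-- Summation by parts on `ℤ` for finitely supported sequences:
`Σ_i ⟪g (i+1) − g i, a i⟫ = − Σ_i ⟪g i, a i − a (i−1)⟫`. [folklore] -/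
theorem tsum_inner_diff_eq_neg {g a : ℤ → EuclideanSpace ℝ (Fin 3)} (hg : (Function.support g).Finite)
    (ha : (Function.support a).Finite) :
    ∑' i : ℤ, ⟪g (i + 1) - g i, a i⟫ = -∑' i : ℤ, ⟪g i, a i - a (i - 1)⟫ := by
  have hs1 : Summable fun i : ℤ => ⟪g (i + 1), a i⟫ := by
    refine summable_of_hasFiniteSupport (ha.subset fun i hi => ?_)
    rw [Function.mem_support] at hi ⊢
    intro h0; exact hi (by rw [h0, inner_zero_right])
  have hs2 : Summable fun i : ℤ => ⟪g i, a i⟫ := by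
    refine summable_of_hasFiniteSupport (ha.subset fun i hi => ?_)
    rw [Function.mem_support] at hi ⊢
    intro h0; exact hi (by rw [h0, inner_zero_right])
  have hs3 : Summable fun i : ℤ => ⟪g i, a (i - 1)⟫ := by
    refine summable_of_hasFiniteSupport (hg.subset fun i hi => ?_)
    rw [Function.mem_support] at hi ⊢
    intro h0; exact hi (by rw [h0, inner_zero_left])
  have hshift : ∑' i : ℤ, ⟪g (i + 1), a i⟫ = ∑' i : ℤ, ⟪g i, a (i - 1)⟫ := by
    rw [← (Equiv.subRight (1 : ℤ)).tsum_eq (fun i : ℤ => ⟪g (i + 1), a i⟫)]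
    refine tsum_congr fun i => ?_
    simp only [Equiv.subRight_apply, sub_add_cancel]
  calc ∑' i : ℤ, ⟪g (i + 1) - g i, a i⟫ = ∑' i : ℤ, (⟪g (i + 1), a i⟫ - ⟪g i, a i⟫) :=
        tsum_congr fun i => by rw [inner_sub_left]
    _ = ∑' i : ℤ, ⟪g (i + 1), a i⟫ - ∑' i : ℤ, ⟪g i, a i⟫ := hs1.tsum_sub hs2
    _ = ∑' i : ℤ, ⟪g i, a (i - 1)⟫ - ∑' i : ℤ, ⟪g i, a i⟫ := by rw [hshift]
    _ = -∑' i : ℤ, (⟪g i, a i⟫ - ⟪g i, a (i - 1)⟫) := by rw [hs2.tsum_sub hs3]; ring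
    _ = -∑' i : ℤ, ⟪g i, a i - a (i - 1)⟫ := by
        congr 1; exact tsum_congr fun i => by rw [inner_sub_right]

/-- The differences of a finitely supported sequence are finitely supported. [folklore] -/
theorem finite_support_diff {g : ℤ → EuclideanSpace ℝ (Fin 3)} (hg : (Function.support g).Finite) (c : ℤ) :
    (Function.support fun i : ℤ => g (i + c) - g i).Finite := by
  have h1 : (Function.support fun i : ℤ => g (i + c)).Finite := by
    have : (Function.support fun i : ℤ => g (i + c)) = (fun j => j - c) '' Function.support g := by
      ext i; simp only [Function.mem_support, Set.mem_image]
      constructor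
      · intro hi; exact ⟨i + c, hi, by ring⟩
      · rintro ⟨j, hj, rfl⟩; simpa using hj
    rw [this]; exact hg.image _
  refine (h1.union hg).subset fun i hi => ?_
  by_contra hcon
  simp only [Set.mem_union, Function.mem_support, not_or, not_not] at hcon
  exact hi (by simp [hcon.1, hcon.2])

/-- The quartic sum as a summation-by-parts expression:
`Σ ‖Dg_i‖⁴ = −Σ ⟪g_i, ‖Dg_i‖²•Dg_i − ‖Dg_{i−1}‖²•Dg_{i−1}⟫`. [folklore] -/
theorem tsum_norm_diff_pow_four_eq {g : ℤ → EuclideanSpace ℝ (Fin 3)} (hg : (Function.support g).Finite) :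
    ∑' i : ℤ, ‖g (i + 1) - g i‖ ^ 4 =
      -∑' i : ℤ, ⟪g i, (‖(g (i + 1) - g i)‖ ^ 2) • (g (i + 1) - g i) - (‖(g i - g (i - 1))‖ ^ 2) • (g i - g (i - 1))⟫ := by
  have hd := finite_support_diff hg 1
  have ha : (Function.support fun i : ℤ => (‖(g (i + 1) - g i)‖ ^ 2) • (g (i + 1) - g i)).Finite := hd.subset fun i hi => by
    rw [Function.mem_support] at hi ⊢
    intro h0; exact hi (by rw [h0, smul_zero])
  have h := tsum_inner_diff_eq_neg (g := g) (a := fun i : ℤ => (‖(g (i + 1) - g i)‖ ^ 2) • (g (i + 1) - g i)) hg ha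
  have e1 : ∑' i : ℤ, ‖g (i + 1) - g i‖ ^ 4 = ∑' i : ℤ, ⟪g (i + 1) - g i, (‖(g (i + 1) - g i)‖ ^ 2) • (g (i + 1) - g i)⟫ := by
    refine tsum_congr fun i => ?_
    rw [real_inner_smul_right, real_inner_self_eq_norm_sq]; ring
  rw [e1, h]
  congr 1
  refine tsum_congr fun i => ?_
  simp only [sub_add_cancel]

/-- Pointwise majorant of the summation-by-parts term, with a free parameter `θ > 0`:
`|⟪g_i, Δa_i⟫| ≤ M·(3/2)·(θ(‖Dg_i‖⁴ + ‖Dg_{i−1}‖⁴) + θ⁻¹‖D²g_{i−1}‖²)`. [folklore] -/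
theorem abs_inner_cube_diff_le {g : ℤ → EuclideanSpace ℝ (Fin 3)} {M : ℝ} (hM : ∀ i, ‖g i‖ ≤ M) {θ : ℝ} (hθ : 0 < θ)
    (i : ℤ) :
    |⟪g i, (‖(g (i + 1) - g i)‖ ^ 2) • (g (i + 1) - g i) - (‖(g i - g (i - 1))‖ ^ 2) • (g i - g (i - 1))⟫| ≤
      M * (3 / 2) * (θ * (‖g (i + 1) - g i‖ ^ 4 + ‖g i - g (i - 1)‖ ^ 4) +
        θ⁻¹ * ‖g (i + 1) - (2 : ℝ) • g i + g (i - 1)‖ ^ 2) := by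
  have hM0 : 0 ≤ M := (norm_nonneg _).trans (hM i)
  have hdd : (g (i + 1) - g i) - (g i - g (i - 1)) = g (i + 1) - (2 : ℝ) • g i + g (i - 1) := by
    rw [two_smul]; abel
  have hcube := norm_cube_sub_cube_le (g (i + 1) - g i) (g i - g (i - 1))
  rw [hdd] at hcube
  have h1 := (abs_real_inner_le_norm (g i) ((‖(g (i + 1) - g i)‖ ^ 2) • (g (i + 1) - g i) - (‖(g i - g (i - 1))‖ ^ 2) • (g i - g (i - 1)))).trans
    (mul_le_mul (hM i) hcube (norm_nonneg _) hM0)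
  refine h1.trans ?_
  set X := ‖g (i + 1) - g i‖ ^ 2 + ‖g i - g (i - 1)‖ ^ 2 with hX
  set Z := ‖g (i + 1) - (2 : ℝ) • g i + g (i - 1)‖ with hZ
  have hX2 : X ^ 2 ≤ 2 * (‖g (i + 1) - g i‖ ^ 4 + ‖g i - g (i - 1)‖ ^ 4) := by
    rw [hX]; nlinarith [sq_nonneg (‖g (i + 1) - g i‖ ^ 2 - ‖g i - g (i - 1)‖ ^ 2)]
  have hamgm : X * Z ≤ θ / 2 * X ^ 2 + θ⁻¹ / 2 * Z ^ 2 := by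
    have h0 := sq_nonneg (θ * X - Z)
    have hθ' : θ⁻¹ * θ = 1 := inv_mul_cancel₀ hθ.ne'
    have hθθ : θ⁻¹ * (θ * X - Z) ^ 2 = θ * X ^ 2 - 2 * (X * Z) + θ⁻¹ * Z ^ 2 := by
      field_simp; ring
    have := mul_nonneg (inv_nonneg.2 hθ.le) h0
    rw [hθθ] at this
    linarith
  have hZ2 : 0 ≤ θ⁻¹ * Z ^ 2 := mul_nonneg (inv_nonneg.2 hθ.le) (sq_nonneg _)
  have hfin : 3 / 2 * X * Z ≤ 3 / 2 * (θ * (‖g (i + 1) - g i‖ ^ 4 + ‖g i - g (i - 1)‖ ^ 4) + θ⁻¹ * Z ^ 2) := by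
    nlinarith [hamgm, hX2, hZ2, hθ.le]
  calc M * (3 / 2 * X * Z) ≤ M * (3 / 2 * (θ * (‖g (i + 1) - g i‖ ^ 4 + ‖g i - g (i - 1)‖ ^ 4) + θ⁻¹ * Z ^ 2)) :=
        mul_le_mul_of_nonneg_left hfin hM0
    _ = _ := by ring

/-- **1-D discrete Gagliardo–Nirenberg inequality** (see the module docstring). [folklore] -/
theorem tsum_norm_diff_pow_four_le {g : ℤ → EuclideanSpace ℝ (Fin 3)} (hg : (Function.support g).Finite)
    {M : ℝ} (hM : ∀ i, ‖g i‖ ≤ M) :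
    ∑' i : ℤ, ‖g (i + 1) - g i‖ ^ 4 ≤ 72 * M ^ 2 * ∑' i : ℤ, ‖g (i + 2) - (2 : ℝ) • g (i + 1) + g i‖ ^ 2 := by
  have hM0 : 0 ≤ M := (norm_nonneg _).trans (hM 0)
  -- summable pieces (all finitely supported)
  have hd := finite_support_diff hg 1
  have hdm : (Function.support fun i : ℤ => g i - g (i - 1)).Finite := by
    have h' := finite_support_diff hg (-1)
    have heq : (Function.support fun i : ℤ => g i - g (i - 1)) = (Function.support fun i : ℤ => g (i + -1) - g i) := by
      ext i
      simp only [Function.mem_support, ne_eq, sub_eq_zero, ← sub_eq_add_neg]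
      exact ⟨fun h h' => h h'.symm, fun h h' => h h'.symm⟩
    rw [heq]; exact h'
  have h4 : Summable fun i : ℤ => ‖g (i + 1) - g i‖ ^ 4 := by
    refine summable_of_hasFiniteSupport (hd.subset fun i hi => ?_)
    rw [Function.mem_support] at hi ⊢; intro h0; exact hi (by rw [h0, norm_zero, zero_pow four_ne_zero])
  have h4m : Summable fun i : ℤ => ‖g i - g (i - 1)‖ ^ 4 := by
    refine summable_of_hasFiniteSupport (hdm.subset fun i hi => ?_)
    rw [Function.mem_support] at hi ⊢; intro h0; exact hi (by rw [h0, norm_zero, zero_pow four_ne_zero])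
  have hD2supp : (Function.support fun i : ℤ => g (i + 1) - (2 : ℝ) • g i + g (i - 1)).Finite := by
    refine (hd.union hdm).subset fun i hi => ?_
    by_contra hcon
    simp only [Set.mem_union, Function.mem_support, not_or, not_not] at hcon
    have : g (i + 1) - (2 : ℝ) • g i + g (i - 1) = (g (i + 1) - g i) - (g i - g (i - 1)) := by rw [two_smul]; abel
    exact hi (by show g (i + 1) - (2 : ℝ) • g i + g (i - 1) = 0; rw [this, hcon.1, hcon.2, sub_zero])
  have hD2 : Summable fun i : ℤ => ‖g (i + 1) - (2 : ℝ) • g i + g (i - 1)‖ ^ 2 := by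
    refine summable_of_hasFiniteSupport (hD2supp.subset fun i hi => ?_)
    rw [Function.mem_support] at hi ⊢; intro h0; exact hi (by rw [h0, norm_zero, zero_pow two_ne_zero])
  set A4 : ℝ := ∑' i : ℤ, ‖g (i + 1) - g i‖ ^ 4 with hA4
  set B2 : ℝ := ∑' i : ℤ, ‖g (i + 1) - (2 : ℝ) • g i + g (i - 1)‖ ^ 2 with hB2
  have hB20 : 0 ≤ B2 := tsum_nonneg fun i => by positivity
  have hshift4 : ∑' i : ℤ, ‖g i - g (i - 1)‖ ^ 4 = A4 := by
    rw [hA4, ← (Equiv.subRight (1 : ℤ)).tsum_eq (fun i : ℤ => ‖g (i + 1) - g i‖ ^ 4)]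
    exact tsum_congr fun i => by simp only [Equiv.subRight_apply, sub_add_cancel]
  have hB2eq : B2 = ∑' i : ℤ, ‖g (i + 2) - (2 : ℝ) • g (i + 1) + g i‖ ^ 2 := by
    rw [hB2, ← (Equiv.addRight (1 : ℤ)).tsum_eq (fun i : ℤ => ‖g (i + 1) - (2 : ℝ) • g i + g (i - 1)‖ ^ 2)]
    refine tsum_congr fun i => ?_
    simp only [Equiv.coe_addRight, add_sub_cancel_right]
    ring_nf
  -- the main inequality for every θ > 0
  have hmain : ∀ θ : ℝ, 0 < θ → A4 ≤ M * (3 / 2) * (θ * (2 * A4) + θ⁻¹ * B2) := by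
    intro θ hθ
    have hpt := fun i => abs_inner_cube_diff_le hM hθ i
    have hR : Summable fun i : ℤ => M * (3 / 2) * (θ * (‖g (i + 1) - g i‖ ^ 4 + ‖g i - g (i - 1)‖ ^ 4) +
        θ⁻¹ * ‖g (i + 1) - (2 : ℝ) • g i + g (i - 1)‖ ^ 2) :=
      (((h4.add h4m).mul_left θ).add (hD2.mul_left θ⁻¹)).mul_left _
    have hL : Summable fun i : ℤ => |⟪g i, (‖(g (i + 1) - g i)‖ ^ 2) • (g (i + 1) - g i) - (‖(g i - g (i - 1))‖ ^ 2) • (g i - g (i - 1))⟫| :=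
      Summable.of_nonneg_of_le (fun i => abs_nonneg _) hpt hR
    have hsum : ∑' i : ℤ, |⟪g i, (‖(g (i + 1) - g i)‖ ^ 2) • (g (i + 1) - g i) - (‖(g i - g (i - 1))‖ ^ 2) • (g i - g (i - 1))⟫| ≤ M * (3 / 2) * (θ * (2 * A4) + θ⁻¹ * B2) := by
      refine (hL.tsum_le_tsum hpt hR).trans (le_of_eq ?_)
      rw [tsum_mul_left, ((h4.add h4m).mul_left θ).tsum_add (hD2.mul_left θ⁻¹), tsum_mul_left, tsum_mul_left,
        h4.tsum_add h4m, hshift4]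
      ring
    have hA4' : A4 = -∑' i : ℤ, ⟪g i, (‖(g (i + 1) - g i)‖ ^ 2) • (g (i + 1) - g i) - (‖(g i - g (i - 1))‖ ^ 2) • (g i - g (i - 1))⟫ := by
      rw [hA4]; exact tsum_norm_diff_pow_four_eq hg
    have habs : ‖∑' i : ℤ, ⟪g i, (‖(g (i + 1) - g i)‖ ^ 2) • (g (i + 1) - g i) - (‖(g i - g (i - 1))‖ ^ 2) • (g i - g (i - 1))⟫‖ ≤
        ∑' i : ℤ, |⟪g i, (‖(g (i + 1) - g i)‖ ^ 2) • (g (i + 1) - g i) - (‖(g i - g (i - 1))‖ ^ 2) • (g i - g (i - 1))⟫| :=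
      norm_tsum_le_tsum_norm hL
    rw [Real.norm_eq_abs] at habs
    calc A4 = _ := hA4'
      _ ≤ |∑' i : ℤ, ⟪g i, (‖(g (i + 1) - g i)‖ ^ 2) • (g (i + 1) - g i) - (‖(g i - g (i - 1))‖ ^ 2) • (g i - g (i - 1))⟫| :=
          neg_le_abs _
      _ ≤ _ := habs.trans hsum
  rw [← hB2eq]
  by_cases hMz : M = 0
  · have hg0 : ∀ i, g i = 0 := fun i => by
      have := hM i; rw [hMz] at this; exact norm_le_zero_iff.1 this
    have : A4 = 0 := by rw [hA4]; simp [hg0]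
    rw [this]; positivity
  · have hMpos : 0 < M := lt_of_le_of_ne hM0 (Ne.symm hMz)
    have hθ : (0 : ℝ) < 1 / (6 * M) := by positivity
    have h := hmain _ hθ
    have e1 : M * (3 / 2) * (1 / (6 * M) * (2 * A4) + (1 / (6 * M))⁻¹ * B2) = A4 / 2 + 9 * M ^ 2 * B2 := by
      field_simp; ring
    rw [e1] at h
    nlinarith [h, hB20, sq_nonneg M]

end Summit.AtomisticToContinuum.Crystallization.Theorems.ExcessDecayLiouville

end
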